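import Summits.ABC.IUTFork.Cor312SlotLicenceContentCriterion
import Summits.ABC.IUTFork.Cor312PilotIdelesPrSlotHull
import Summits.ABC.IUTFork.Cor312PilotIdelesPrInclusion
import Literature.IUT.LogVolume.TensorPacketContentExact
import HarnessLib

/-!
# [IUTchIII] Cor. 3.12, Step (xi-f) IN READING (P): the SLOT LICENCE at the K-LEVEL print-normalised sharp setting `settingPrVolSharp`, decided
# EXACTLY per summand by the content of the LAST-slot box and the radii of the unit-log lattices — ALL strata (tame, boundary, wild, `p = 2`)

PROOF-ONLY file (D-0012; no definitions, no `Prop` facts, no instances) of the abc-iut cell (branch C certificate seat abc-iut-C-cert-2 gen 4;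
row «P:M-SLOT-LICENCE-EXACT», K twin). The K-LEVEL twin of this seat's `Cor312SlotLicenceExactContentM` (p470778), over the SAME generic slot criterion
`Cor312SlotLicenceContentCriterion` (p470445); supersedes in scope this seat's stratum-wise K deciders `Cor312SlotLicenceTameIff` (p462292, uniformly TAME
realising data) and abc-iut-D1-prv's `Cor312SlotLicenceBall` (boundary): HERE NO STRATUM HYPOTHESIS. TAKES NO SIDE on [IUTchIII] Cor. 3.12 (kurims manuscript
p. 173–174; Step (x) p. 181, Step (xi-f) p. 184) or on the reading (U)/(P).

OBJECT: `Cor312.Setting.SlotLicence` (abc-iut-C-cert-2 `Cor312SlotHull`, p458847) — the S-side clause of the K-line γ / joint certificates OF RECORD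
(`abc_of_slotLicence_orNumP_K_content_read` p462946 [hNumPOffC], `abc_of_jointLicence_K_content` p464272 [hNumJointC], and their Szpiro-bad twins): their binders
are demanded exactly where OUR slot licence FAILS — at abc-iut-c312-7's print-normalised SHARP real setting `Thm311.Real.settingPrVolSharp X hlog … tq t htq0 htq1`
(ALL places of the field `F` of the pilot data `X`, packet-normalised volumes, sharp Dupuy–Hilado Θ-boxes read off Θ-ideles `t`, q-centre off `tq`). PROVED:
* §1 `hsub` / `hwit` dischargers (region = product of the last-slot boxes, abc-iut-s2-p7 `thetaRegion3_settingPrVolSharp_eq_preimage_pi_sharpBox`; Ism of the real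
  log-shells is FULL, abc-iut-s2-p9 `exists_ismDH_presAt_of_image_logUnits_eq` p449844) and **`qRegion_subset_thetaSlotHull_settingPrVolSharp_iff_of_content`**
  («⟺ ∀ v⃗, p^{m(v⃗)}·‖t_{q,v_j}‖ ≤ ∏_a ‖cout(v_a)‖», `m` the EXACT content of the last-slot box); `…_inl` (archimedean packets automatic);
* §2 **`…_iff`** (content-free) and **`qRegion_subset_thetaSlotHull_settingPrVolSharp_iff_radii`** («⟺ ∀ v⃗ ∀ m, (∀ J, p^m·‖t_{Θ,j,v_j}‖ ≤ p^{−(d_I−d_{L_J})}·∏_b ρ_in(v_b))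
  → p^m·‖t_{q,v_j}‖ ≤ ∏_b ρ_out(v_b)»; abc-iut-c312-5's exact content cell);
* §3 **`slotLicence_settingPrVolSharp_iff_radii`** — `SlotLicence (settingPrVolSharp X …)` ⟺ the §2 condition at every prime and every label `i+1`.

READING (neutral; numbers, not adjectives): at every prime the truth value of OUR typed slot licence of the K line is a finite lattice computation per summand
in ONE q-idele norm, ONE Θ-idele norm (the last slot) and the radii/differents of `log_p(𝒪^×_{F_v})` — the SAME per-place columns as the R-W WINDOW-TABLE's
(U) predicates, with the slot index fixed to the last slot. HONEST SCOPE: STRONGER-THAN-PRINT set-level reading of Step (xi-f) (print: hull of the union of ALL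
possible images, p. 184 l. 26–29); OUR sharp containers, OUR typed (Ind2)/(Ind3); nothing here bears on the printed GLOBAL inequality or on the NUMBER-level
per-image Corollary; decided-as-typed ≠ decided-in-print. [cite: Mochizuki2012, IUTchIII Cor. 3.12 p. 173–174, Step (x) p. 181, Step (xi) p. 183–184; Thm. 3.11
(i) (Ind2) p. 154; Rmk. 3.9.5 (i)(ii) p. 127; IUTchIV Prop. 1.1 p. 9, Prop. 1.2 (i)(ii) p. 10] [cite: DupuyHilado2025, §3.7, §3.9, §4.9, §4.11–4.12]
[cite: WeilBNT1967, Ch. II §2, Th. 1–2] [claim: Mochizuki2012, status: disputed] for every IUT sentence quoted. typed ≠ proved (these: proved); instantiated ≠ endorsed.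
-/

noncomputable section

open Set Function NumberField IsDedekindDomain
open scoped Pointwise

namespace Summit.ABC.IUTFork.Thm311.Real

open Cor312 Cor312Vol Literature.IUT.LogThetaLattice Literature.IUT.LogVolume
  Literature.NumberTheory.NumberFields Literature.NumberTheory.GaloisRepresentations.Ultrametric

variable {F : Type} [Field F] [NumberField F] (X : PilotData F) {logv : PadicLogs F} (hlog : LogvAnalytic logv)
  (M : Type) [Field M] [NumberField M]
  (archPk : ∀ (j : (thetaIndex X).Label) (vQ : (thetaIndex X).VQ), Set ((logShellsDH X logv).Packet j vQ))
  (archSub : ∀ (j : (thetaIndex X).Label) (v : (thetaIndex X).V),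
    Set ((logShellsDH X logv).Packet j ((thetaIndex X).over v)))
  (Ψ : ℤ → ∀ v : (thetaIndex X).V, v ∈ (thetaIndex X).Vbad → Set ((logShellsDH X logv).StarPacket v))
  (act : ℤ → ∀ v : (thetaIndex X).V, v ∈ (thetaIndex X).Vbad →
    (logShellsDH X logv).StarPacket v → Module.End ℚ ((logShellsDH X logv).StarPacket v))
  (Mmod : ℤ → ∀ j : (thetaIndex X).LabelStar, Set ((logShellsDH X logv).GlobalPacket j.1))
  (region : ℤ → ∀ j : (thetaIndex X).LabelStar, FinDivisor M → ∀ vQ : (thetaIndex X).VQ,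
    Set ((logShellsDH X logv).Packet j.1 vQ))
  (n : ℤ) {HT : Type} {LogLink : HT → HT → Type} {IsFull : ∀ {s t : HT}, LogLink s t → Prop}
  (lat : LGPGaussianLogThetaLattice LogLink IsFull)
  {Frd : Type} {IsoF : Frd → Frd → Type} {Ob : Frd → Type} {realify : Frd → Frd} {Strip : Type}
  {IsoS : Strip → Strip → Type} {Mv : ∀ v : (thetaIndex X).V, v ∈ (thetaIndex X).Vbad → Type}
  [∀ v h, Monoid (Mv v h)]
  (sig : GlobalLGPFrobenioidSignature (thetaIndex X).lstar (thetaIndex X).V (· ∈ (thetaIndex X).Vbad)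
    Frd IsoF Ob realify Strip IsoS Mv)
  (split : SplittingMonoids Mv) {ObΔ : Type} {N : ∀ v : (thetaIndex X).V, v ∈ (thetaIndex X).Vbad → Type}
  [∀ v h, Monoid (N v h)] (qData : QPilotData ObΔ N)
  (t : ∀ (pp : Nat.Primes) (_ : Fin X.lstar) (x : (thetaIndex X).Fibre (.inr pp)),
    haveI : Fact (pp : ℕ).Prime := ⟨pp.2⟩; kOf X pp.1 x)
  (tq : ∀ (pp : Nat.Primes) (x : (thetaIndex X).Fibre (.inr pp)), haveI : Fact (pp : ℕ).Prime := ⟨pp.2⟩; kOf X pp.1 x)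
  (htq0 : ∀ pp x, tq pp x ≠ 0)
  (htq1 : ∀ (pp : Nat.Primes) (x : (thetaIndex X).Fibre (.inr pp)),
    haveI : Fact (pp : ℕ).Prime := ⟨pp.2⟩; placeOf X pp.1 x ∉ X.S → ‖tq pp x‖ = 1)


/-! ## §1. The dischargers and the per-packet SLOT criterion with a content family -/

/-- **`hsub` for the SLOT images at the K-level sharp setting, ANY label**: if every LAST-slot box `ι_j(t_{Θ,j,v_j})·(R_I)^∼` at `(j, p)` lies in
`p^{m(v⃗)}·log_p(R_{v⃗}^×)`, then so does, summand-wise, the union of the SLOT images (region = product of the last-slot boxes, abc-iut-s2-p7; (Ind2)-families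
map the lattice onto itself, NO capsule symmetry). [cite: DupuyHilado2025, §3.9, §4.9, §4.11] [cite: Mochizuki2012, IUTchIII Thm. 3.11 (i) (Ind2) p. 154] -/
theorem sUnion_thetaSlotImages_settingPrVolSharp_subset (j : (thetaIndex X).Label) (pp : Nat.Primes)
    (m : ((thetaIndex X).Caps j → (thetaIndex X).Fibre (.inr pp)) → ℤ)
    (hm0 : ∀ e : (thetaIndex X).Caps j → (thetaIndex X).Fibre (.inr pp),
      haveI : Fact (pp : ℕ).Prime := ⟨pp.2⟩
      iota pp.1 ((presAtPr X hlog pp).kk e) (Fin.last _) ((presAtPr X hlog pp).labelIdele (t pp) j (e (Fin.last _))) •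
          (normalizedPacket pp.1 ((presAtPr X hlog pp).kk e) : Set ((presAtPr X hlog pp).X e)) ⊆
        (((pp : ℕ) : ℚ_[pp]) ^ m e) • (logPacket pp.1 ((presAtPr X hlog pp).kk e) : Set ((presAtPr X hlog pp).X e))) :
    haveI : Fact (pp : ℕ).Prime := ⟨pp.2⟩
    ⋃₀ (settingPrVolSharp X hlog M archPk archSub Ψ act Mmod region n lat sig split qData tq t htq0 htq1).thetaSlotImages j (.inr pp) ⊆
      (presAtPr X hlog pp).comparison j ⁻¹' Set.pi univ fun e =>
        (((pp : ℕ) : ℚ_[pp]) ^ m e) • (logPacket pp.1 ((presAtPr X hlog pp).kk e) : Set ((presAtPr X hlog pp).X e)) := by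
  haveI : Fact (pp : ℕ).Prime := ⟨pp.2⟩
  refine sUnion_thetaSlotImages_subset_preimage_pi_zpow_smul_logPacket (P := (settingPrVolSharp X hlog M archPk archSub Ψ act Mmod region n lat sig split qData tq t htq0 htq1)) (presAtPr X hlog pp) j m ?_
  rw [thetaRegion3_settingPrVolSharp_eq_preimage_pi_sharpBox X hlog M archPk archSub Ψ act Mmod region n lat sig split qData t tq htq0 htq1 j pp]
  refine Set.preimage_mono (Set.pi_mono fun e _ => ?_)
  rw [PadicPresentation.sharpBox]
  exact hm0 e

/-- **`hwit` for the SLOT criterion at the K-level sharp setting, any label, any Θ-ideles**: the (Ind3)-region carries at every summand `v⃗` a vector of content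
exactly `p^{m(v⃗)}` when `m(v⃗)` is the EXACT content of the LAST-slot box (abc-iut-s2-p7 `exists_mem_thetaRegion3_comparison_eq`). [cite: DupuyHilado2025, §3.7, §3.9] -/
theorem exists_mem_thetaRegion3_settingPrVolSharp_exact_content (j : (thetaIndex X).Label) (pp : Nat.Primes)
    (m : ((thetaIndex X).Caps j → (thetaIndex X).Fibre (.inr pp)) → ℤ)
    (e : (thetaIndex X).Caps j → (thetaIndex X).Fibre (.inr pp))
    (hm0 : haveI : Fact (pp : ℕ).Prime := ⟨pp.2⟩
      iota pp.1 ((presAtPr X hlog pp).kk e) (Fin.last _) ((presAtPr X hlog pp).labelIdele (t pp) j (e (Fin.last _))) •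
        (normalizedPacket pp.1 ((presAtPr X hlog pp).kk e) : Set ((presAtPr X hlog pp).X e)) ⊆
      (((pp : ℕ) : ℚ_[pp]) ^ m e) • (logPacket pp.1 ((presAtPr X hlog pp).kk e) : Set ((presAtPr X hlog pp).X e)))
    (hm1 : haveI : Fact (pp : ℕ).Prime := ⟨pp.2⟩
      ¬ iota pp.1 ((presAtPr X hlog pp).kk e) (Fin.last _) ((presAtPr X hlog pp).labelIdele (t pp) j (e (Fin.last _))) •
        (normalizedPacket pp.1 ((presAtPr X hlog pp).kk e) : Set ((presAtPr X hlog pp).X e)) ⊆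
      (((pp : ℕ) : ℚ_[pp]) ^ (m e + 1)) • (logPacket pp.1 ((presAtPr X hlog pp).kk e) : Set ((presAtPr X hlog pp).X e))) :
    haveI : Fact (pp : ℕ).Prime := ⟨pp.2⟩
    ∃ x ∈ (settingPrVolSharp X hlog M archPk archSub Ψ act Mmod region n lat sig split qData tq t htq0 htq1).thetaRegion3 j (.inr pp),
      (presAtPr X hlog pp).comparison j x e ∈
          (((pp : ℕ) : ℚ_[pp]) ^ m e) • (logPacket pp.1 ((presAtPr X hlog pp).kk e) : Set ((presAtPr X hlog pp).X e)) ∧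
        (presAtPr X hlog pp).comparison j x e ∉
          (((pp : ℕ) : ℚ_[pp]) ^ (m e + 1)) • (logPacket pp.1 ((presAtPr X hlog pp).kk e) : Set ((presAtPr X hlog pp).X e)) := by
  classical
  haveI : Fact (pp : ℕ).Prime := ⟨pp.2⟩
  obtain ⟨y, hyB, hy1⟩ := Set.not_subset.mp hm1
  have hy0 := hm0 hyB
  have hbox : (presAtPr X hlog pp).sharpBox (t pp) j e =
      iota pp.1 ((presAtPr X hlog pp).kk e) (Fin.last _) ((presAtPr X hlog pp).labelIdele (t pp) j (e (Fin.last _))) •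
        (normalizedPacket pp.1 ((presAtPr X hlog pp).kk e) : Set ((presAtPr X hlog pp).X e)) := by
    rw [PadicPresentation.sharpBox]
  have hB0 : ∀ e', (0 : (presAtPr X hlog pp).X e') ∈ (presAtPr X hlog pp).sharpBox (t pp) j e' :=
    fun e' => Set.mem_smul_set.mpr ⟨0, Subring.zero_mem _, smul_zero _⟩
  obtain ⟨x, hxR, hx⟩ := exists_mem_thetaRegion3_comparison_eq (P := (settingPrVolSharp X hlog M archPk archSub Ψ act Mmod region n lat sig split qData tq t htq0 htq1)) (presAtPr X hlog pp) j
    ((presAtPr X hlog pp).sharpBox (t pp) j)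
    (subset_of_eq (thetaRegion3_settingPrVolSharp_eq_preimage_pi_sharpBox X hlog M archPk archSub Ψ act Mmod region n lat sig split qData t tq
      htq0 htq1 j pp).symm)
    hB0 e (z := y) (by rw [hbox]; exact hyB)
  refine ⟨x, hxR, ?_⟩
  have hxy : (presAtPr X hlog pp).comparison j x e = y := hx
  rw [hxy]
  exact ⟨hy0, hy1⟩

/-- **THE PER-PACKET SLOT CRITERION AT THE K LEVEL (content form)**: for the EXACT content family `m` of the LAST-slot boxes and elements `cout(v)` of LARGEST norm
in the `log_p(𝒪^×_{F_v})`: `qRegion (j,p) ⊆ slot hull (j,p) ⟺ ∀ v⃗, p^{m(v⃗)}·‖t_{q,v_j}‖ ≤ ∏_a ‖cout(v_a)‖` (generic criterion at abc-iut-c312-3's presentation: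
`hframe` definitional, `hq` by `factorMap_preimage_hullSet_qCentre` + abc-iut-c312-7 `qRegion_settingPrVolSharp_inr`, `hism` abc-iut-s2-p9's fullness of Ism
landing in the (Ind2)-families). [cite: Mochizuki2012, IUTchIII Cor. 3.12 Step (x) p. 181, Step (xi-f) p. 184] [cite: DupuyHilado2025, §3.9, §4.9, §4.12] -/
theorem qRegion_subset_thetaSlotHull_settingPrVolSharp_iff_of_content (j : (thetaIndex X).Label) (pp : Nat.Primes)
    (m : ((thetaIndex X).Caps j → (thetaIndex X).Fibre (.inr pp)) → ℤ)
    (hm0 : ∀ e : (thetaIndex X).Caps j → (thetaIndex X).Fibre (.inr pp),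
      haveI : Fact (pp : ℕ).Prime := ⟨pp.2⟩
      iota pp.1 ((presAtPr X hlog pp).kk e) (Fin.last _) ((presAtPr X hlog pp).labelIdele (t pp) j (e (Fin.last _))) •
          (normalizedPacket pp.1 ((presAtPr X hlog pp).kk e) : Set ((presAtPr X hlog pp).X e)) ⊆
        (((pp : ℕ) : ℚ_[pp]) ^ m e) • (logPacket pp.1 ((presAtPr X hlog pp).kk e) : Set ((presAtPr X hlog pp).X e)))
    (hm1 : ∀ e : (thetaIndex X).Caps j → (thetaIndex X).Fibre (.inr pp),
      haveI : Fact (pp : ℕ).Prime := ⟨pp.2⟩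
      ¬ iota pp.1 ((presAtPr X hlog pp).kk e) (Fin.last _) ((presAtPr X hlog pp).labelIdele (t pp) j (e (Fin.last _))) •
          (normalizedPacket pp.1 ((presAtPr X hlog pp).kk e) : Set ((presAtPr X hlog pp).X e)) ⊆
        (((pp : ℕ) : ℚ_[pp]) ^ (m e + 1)) • (logPacket pp.1 ((presAtPr X hlog pp).kk e) : Set ((presAtPr X hlog pp).X e)))
    (cout : ∀ x : (thetaIndex X).Fibre (.inr pp), haveI : Fact (pp : ℕ).Prime := ⟨pp.2⟩; kOf X pp.1 x)
    (houtΛ : ∀ x, haveI : Fact (pp : ℕ).Prime := ⟨pp.2⟩; cout x ∈ logUnits (kOf X pp.1 x))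
    (hdom : ∀ x, haveI : Fact (pp : ℕ).Prime := ⟨pp.2⟩; ∀ z ∈ logUnits (kOf X pp.1 x), ‖z‖ ≤ ‖cout x‖) :
    (settingPrVolSharp X hlog M archPk archSub Ψ act Mmod region n lat sig split qData tq t htq0 htq1).qRegion j (.inr pp) ⊆ (settingPrVolSharp X hlog M archPk archSub Ψ act Mmod region n lat sig split qData tq t htq0 htq1).thetaSlotHull j (.inr pp) ↔
      ∀ e : (thetaIndex X).Caps j → (thetaIndex X).Fibre (.inr pp),
        (pp : ℝ) ^ m e * ‖tq pp (e (Fin.last _))‖ ≤ ∏ a, ‖cout (e a)‖ := by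
  classical
  haveI : Fact (pp : ℕ).Prime := ⟨pp.2⟩
  letI : Fintype ((presAtPr X hlog pp).factorIdx j) := factorIdxDH_fintype X hlog j (.inr pp)
  have hq : (settingPrVolSharp X hlog M archPk archSub Ψ act Mmod region n lat sig split qData tq t htq0 htq1).qRegion j (.inr pp) =
      (fun x => (presAtPr X hlog pp).factorMap j x) ⁻¹' hullSet ((presAtPr X hlog pp).factorField j) ((presAtPr X hlog pp).qCentre (tq pp) j) := by
    rw [qRegion_settingPrVolSharp_inr X hlog M archPk archSub Ψ act Mmod region n lat sig split qData t tq htq0 htq1 j pp,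
      (presAtPr X hlog pp).factorMap_preimage_hullSet_qCentre (tq pp) (htq0 pp) j]
  have key := qRegion_subset_thetaSlotHull_iff_of_content (P := (settingPrVolSharp X hlog M archPk archSub Ψ act Mmod region n lat sig split qData tq t htq0 htq1)) (presAtPr X hlog pp) j rfl ((presAtPr X hlog pp).qCentre (tq pp) j) hq m
    (sUnion_thetaSlotImages_settingPrVolSharp_subset X hlog M archPk archSub Ψ act Mmod region n lat sig split qData t tq htq0 htq1 j pp m hm0)
    (fun e => exists_mem_thetaRegion3_settingPrVolSharp_exact_content X hlog M archPk archSub Ψ act Mmod region n lat sig split qData t tq htq0 htq1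
      j pp m e (hm0 e) (hm1 e))
    (fun e g' hg' => exists_ind2Family_comparison_eq_congr (S := situationPrVol X hlog M archPk archSub Ψ act Mmod region) (presAtPr X hlog pp) j
      (fun v g'' hg'' => exists_ismDH_presAt_of_image_logUnits_eq X pp.1 logv (hlog pp) v g'' hg'') e g' hg')
    cout houtΛ hdom
  rw [key]
  have hp0 : (0 : ℝ) < (pp : ℕ) := by exact_mod_cast pp.2.pos
  constructor
  · intro h e
    obtain ⟨J⟩ := (inferInstance : Nonempty (DIdx pp.1 ((presAtPr X hlog pp).kk e)))
    have h' := h e J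
    rw [(presAtPr X hlog pp).norm_qCentre (tq pp) j e J, Padic.norm_p_zpow, zpow_neg, ← div_eq_inv_mul,
      le_div_iff₀ (zpow_pos hp0 _), mul_comm] at h'
    exact h'
  · intro h e J
    rw [(presAtPr X hlog pp).norm_qCentre (tq pp) j e J, Padic.norm_p_zpow, zpow_neg, ← div_eq_inv_mul, le_div_iff₀ (zpow_pos hp0 _), mul_comm]
    exact h e

/-- **The archimedean packet is automatic**: at `v_ℚ = ∞` the (Ind3)-region is the whole packet (trivial archimedean container, abc-iut-c312-7
`thetaRegion_settingPrVolSharp_inl`), and the region lies in the slot hull. [cite: Mochizuki2012, IUTchIV Thm. 1.10 Step (vii) p. 30] -/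
theorem qRegion_subset_thetaSlotHull_settingPrVolSharp_inl (j : (thetaIndex X).Label) (u : Unit) :
    (settingPrVolSharp X hlog M archPk archSub Ψ act Mmod region n lat sig split qData tq t htq0 htq1).qRegion j (.inl u) ⊆ (settingPrVolSharp X hlog M archPk archSub Ψ act Mmod region n lat sig split qData tq t htq0 htq1).thetaSlotHull j (.inl u) := by
  intro x _
  have h0 : x ∈ (settingPrVolSharp X hlog M archPk archSub Ψ act Mmod region n lat sig split qData tq t htq0 htq1).thetaRegion3 j (.inl u) := by
    rw [thetaRegion3_settingPrVolSharp_eq X hlog M archPk archSub Ψ act Mmod region n lat sig split qData t tq htq0 htq1 0,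
      thetaRegion_settingPrVolSharp_inl]
    exact Set.mem_univ _
  exact (settingPrVolSharp X hlog M archPk archSub Ψ act Mmod region n lat sig split qData tq t htq0 htq1).thetaRegion3_subset_thetaSlotHull j (.inl u) h0

/-! ## §2. The content-free closed forms -/

/-- **THE PER-PACKET SLOT CRITERION at the K level, content-free**: for NON-ZERO Θ-ideles and `cout(v)` of largest norm in `log_p(𝒪^×_{F_v})`,
`qRegion (j,p) ⊆ slot hull (j,p)` ⟺ for every summand `v⃗` and `m ∈ ℤ` with LAST-slot box `⊆ p^m·log_p(R_{v⃗}^×)`: `p^m·‖t_{q,v_j}‖ ≤ ∏_a ‖cout(v_a)‖`.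
[cite: Mochizuki2012, IUTchIII Cor. 3.12 Step (x) p. 181, Step (xi-f) p. 184] [cite: WeilBNT1967, Ch. II §2, Th. 2] -/
theorem qRegion_subset_thetaSlotHull_settingPrVolSharp_iff (ht0 : ∀ pp i x, t pp i x ≠ 0) (j : (thetaIndex X).Label) (pp : Nat.Primes)
    (cout : ∀ x : (thetaIndex X).Fibre (.inr pp), haveI : Fact (pp : ℕ).Prime := ⟨pp.2⟩; kOf X pp.1 x)
    (houtΛ : ∀ x, haveI : Fact (pp : ℕ).Prime := ⟨pp.2⟩; cout x ∈ logUnits (kOf X pp.1 x))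
    (hdom : ∀ x, haveI : Fact (pp : ℕ).Prime := ⟨pp.2⟩; ∀ z ∈ logUnits (kOf X pp.1 x), ‖z‖ ≤ ‖cout x‖) :
    haveI : Fact (pp : ℕ).Prime := ⟨pp.2⟩
    (settingPrVolSharp X hlog M archPk archSub Ψ act Mmod region n lat sig split qData tq t htq0 htq1).qRegion j (.inr pp) ⊆ (settingPrVolSharp X hlog M archPk archSub Ψ act Mmod region n lat sig split qData tq t htq0 htq1).thetaSlotHull j (.inr pp) ↔
      ∀ (e : (thetaIndex X).Caps j → (thetaIndex X).Fibre (.inr pp)) (m : ℤ),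
        iota pp.1 ((presAtPr X hlog pp).kk e) (Fin.last _) ((presAtPr X hlog pp).labelIdele (t pp) j (e (Fin.last _))) •
            (normalizedPacket pp.1 ((presAtPr X hlog pp).kk e) : Set ((presAtPr X hlog pp).X e)) ⊆
          (((pp : ℕ) : ℚ_[pp]) ^ m) • (logPacket pp.1 ((presAtPr X hlog pp).kk e) : Set ((presAtPr X hlog pp).X e)) →
        (pp : ℝ) ^ m * ‖tq pp (e (Fin.last _))‖ ≤ ∏ a, ‖cout (e a)‖ := by
  classical
  haveI : Fact (pp : ℕ).Prime := ⟨pp.2⟩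
  have hne : ∀ e : (thetaIndex X).Caps j → (thetaIndex X).Fibre (.inr pp),
      ∃ x ∈ iota pp.1 ((presAtPr X hlog pp).kk e) (Fin.last _) ((presAtPr X hlog pp).labelIdele (t pp) j (e (Fin.last _))) •
          (normalizedPacket pp.1 ((presAtPr X hlog pp).kk e) : Set ((presAtPr X hlog pp).X e)), x ≠ 0 := by
    intro e
    refine ⟨iota pp.1 ((presAtPr X hlog pp).kk e) (Fin.last _) ((presAtPr X hlog pp).labelIdele (t pp) j (e (Fin.last _))), ?_,
      (map_ne_zero (iota pp.1 ((presAtPr X hlog pp).kk e) (Fin.last _))).mpr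
        ((presAtPr X hlog pp).labelIdele_ne_zero (t pp) (ht0 pp) j (e (Fin.last _)))⟩
    have h := Set.smul_mem_smul_set
      (a := iota pp.1 ((presAtPr X hlog pp).kk e) (Fin.last _) ((presAtPr X hlog pp).labelIdele (t pp) j (e (Fin.last _))))
      (Subring.one_mem (normalizedPacket pp.1 ((presAtPr X hlog pp).kk e)) : (1 : (presAtPr X hlog pp).X e) ∈
        (normalizedPacket pp.1 ((presAtPr X hlog pp).kk e) : Set ((presAtPr X hlog pp).X e)))
    rwa [smul_eq_mul, mul_one] at h
  have hex := fun e : (thetaIndex X).Caps j → (thetaIndex X).Fibre (.inr pp) =>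
    exists_content pp.1 ((presAtPr X hlog pp).kk e) (isPsiBounded_smul_normalizedPacket pp.1 ((presAtPr X hlog pp).kk e) _) (hne e)
  choose m hm0 hm1 using hex
  rw [qRegion_subset_thetaSlotHull_settingPrVolSharp_iff_of_content X hlog M archPk archSub Ψ act Mmod region n lat sig split qData t tq htq0 htq1
    j pp m hm0 hm1 cout houtΛ hdom]
  have hp1 : (1 : ℝ) ≤ (pp : ℕ) := by exact_mod_cast pp.2.one_lt.le
  refine forall_congr' fun e => ⟨fun h m' hm' => ?_, fun h => h (m e) (hm0 e)⟩
  have hle : m' ≤ m e := by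
    by_contra hlt
    exact hm1 e (hm'.trans (zpow_smul_logPacket_anti pp.1 ((presAtPr X hlog pp).kk e) (by omega)))
  calc ((pp : ℕ) : ℝ) ^ m' * ‖tq pp (e (Fin.last _))‖ ≤ ((pp : ℕ) : ℝ) ^ m e * ‖tq pp (e (Fin.last _))‖ :=
        mul_le_mul_of_nonneg_right (zpow_le_zpow_right₀ hp1 hle) (norm_nonneg _)
    _ ≤ _ := h

section Radii

/-! abc-iut-c312-5's BINDER CONVENTION per place `v` of `F` over `p`: INNER radius `cin p v` (largest ball inside `log_p(𝒪^×_{F_v})`: `hin0`, `hin`, maximality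
`hmax`); OUTER radius `cout p v ∈ log_p(𝒪^×_{F_v})` of largest norm (`houtΛ`, `hdom`); NON-ZERO Θ-ideles (`ht0`). -/

variable (ht0 : ∀ pp i x, t pp i x ≠ 0)
  (cin cout : ∀ (pp : Nat.Primes) (x : (thetaIndex X).Fibre (.inr pp)), haveI : Fact (pp : ℕ).Prime := ⟨pp.2⟩; kOf X pp.1 x)
  (hin0 : ∀ pp x, cin pp x ≠ 0)
  (hin : ∀ (pp : Nat.Primes) (x : (thetaIndex X).Fibre (.inr pp)), haveI : Fact (pp : ℕ).Prime := ⟨pp.2⟩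
    ∀ (o : kOf X pp.1 x), ‖o‖ ≤ 1 → cin pp x * o ∈ logUnits (kOf X pp.1 x))
  (hmax : ∀ (pp : Nat.Primes) (x : (thetaIndex X).Fibre (.inr pp)), haveI : Fact (pp : ℕ).Prime := ⟨pp.2⟩
    ∃ (ϖ : (kOf X pp.1 x)ˣ) (w : kOf X pp.1 x),
      IsUniformizer ϖ ∧ w ∉ logUnits (kOf X pp.1 x) ∧ ‖w‖ * ‖(ϖ : kOf X pp.1 x)‖ ≤ ‖cin pp x‖)
  (houtΛ : ∀ (pp : Nat.Primes) (x : (thetaIndex X).Fibre (.inr pp)), haveI : Fact (pp : ℕ).Prime := ⟨pp.2⟩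
    cout pp x ∈ logUnits (kOf X pp.1 x))
  (hdom : ∀ (pp : Nat.Primes) (x : (thetaIndex X).Fibre (.inr pp)), haveI : Fact (pp : ℕ).Prime := ⟨pp.2⟩
    ∀ z ∈ logUnits (kOf X pp.1 x), ‖z‖ ≤ ‖cout pp x‖)

include ht0 hin0 hin hmax houtΛ hdom

/-- **THE PER-PACKET SLOT CRITERION at the K level in closed form (inner and outer radii)**:
`qRegion (j,p) ⊆ slot hull (j,p) ⟺ ∀ v⃗ ∀ m ∈ ℤ, (∀ J, p^m·‖t_{Θ,j,v_j}‖ ≤ p^{−(d_I − d_{L_J})}·∏_b ρ_in(v_b)) → p^m·‖t_{q,v_j}‖ ≤ ∏_b ρ_out(v_b)`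
(abc-iut-c312-5 `iota_smul_normalizedPacket_subset_zpow_smul_logPacket_iff` at the last slot). [cite: Mochizuki2012, IUTchIV Prop. 1.1 p. 9, Prop. 1.2 (i)(ii) p. 10;
IUTchIII Cor. 3.12 Step (x) p. 181, Step (xi-f) p. 184] [cite: DupuyHilado2025, §3.7, §4.9, §4.12] -/
theorem qRegion_subset_thetaSlotHull_settingPrVolSharp_iff_radii (j : (thetaIndex X).Label) (pp : Nat.Primes) :
    haveI : Fact (pp : ℕ).Prime := ⟨pp.2⟩
    (settingPrVolSharp X hlog M archPk archSub Ψ act Mmod region n lat sig split qData tq t htq0 htq1).qRegion j (.inr pp) ⊆ (settingPrVolSharp X hlog M archPk archSub Ψ act Mmod region n lat sig split qData tq t htq0 htq1).thetaSlotHull j (.inr pp) ↔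
      ∀ (e : (thetaIndex X).Caps j → (thetaIndex X).Fibre (.inr pp)) (m : ℤ),
        (∀ J : DIdx pp.1 ((presAtPr X hlog pp).kk e),
          (pp : ℝ) ^ m * ‖(presAtPr X hlog pp).labelIdele (t pp) j (e (Fin.last _))‖ ≤
            (pp : ℝ) ^ (-(dSum pp.1 ((presAtPr X hlog pp).kk e) - differentOrd pp.1 (DFac pp.1 ((presAtPr X hlog pp).kk e) J))) *
              ∏ b, ‖cin pp (e b)‖) →
        (pp : ℝ) ^ m * ‖tq pp (e (Fin.last _))‖ ≤ ∏ b, ‖cout pp (e b)‖ := by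
  haveI : Fact (pp : ℕ).Prime := ⟨pp.2⟩
  rw [qRegion_subset_thetaSlotHull_settingPrVolSharp_iff X hlog M archPk archSub Ψ act Mmod region n lat sig split qData t tq htq0 htq1 ht0 j pp
    (cout pp) (houtΛ pp) (hdom pp)]
  refine forall_congr' fun e => forall_congr' fun m => imp_congr ?_ Iff.rfl
  exact iota_smul_normalizedPacket_subset_zpow_smul_logPacket_iff pp.1 ((presAtPr X hlog pp).kk e)
    (c := fun b => cin pp (e b)) (fun b => hin0 pp (e b)) (fun b => hin pp (e b)) (fun b => hmax pp (e b)) (Fin.last _) _ m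

/-! ## §3. The SLOT licence of the K-line certificates' setting, decided -/

/-- **THE SLOT LICENCE AT THE K-LEVEL SHARP SETTING, decided — all strata**: abc-iut-C-cert-2's `Cor312.Setting.SlotLicence` of abc-iut-c312-7's
`settingPrVolSharp X hlog … tq t htq0 htq1` ⟺ for every prime `p`, label `i`, summand `v⃗ : S^±_{i+2} → V(F)_p` and `m ∈ ℤ`:
(`∀ J, p^m·‖t_{Θ,i,v_{i+1}}‖ ≤ p^{−(d_I − d_{L_J})}·∏_b ρ_in(v_b)`) `→ p^m·‖t_{q,v_{i+1}}‖ ≤ ∏_b ρ_out(v_b)`. At the CHOSEN realising ideles of a genuine datum this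
is the antecedent of `hNumPOffBad` / `hNumPOffC` (p462946) and — with `¬S_H ∨ mixing` — of `hNumJoint` / `hNumJointC` (p464071 / p464272), NEGATED. NO stratum
hypothesis (the tame decider p462292 and the boundary decider of abc-iut-D1-prv are the special cases where `ρ_in`, `ρ_out` and the exact content are closed
forms in `e` and the orders). [cite: Mochizuki2012, IUTchIII Cor. 3.12 p. 173–174, Step (x) p. 181, Step (xi-f) p. 184] [cite: DupuyHilado2025, §4.9, §4.11–4.12] -/
theorem slotLicence_settingPrVolSharp_iff_radii :
    (settingPrVolSharp X hlog M archPk archSub Ψ act Mmod region n lat sig split qData tq t htq0 htq1).SlotLicence ↔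
      ∀ (pp : Nat.Primes) (i : Fin (thetaIndex X).lstar)
        (e : (thetaIndex X).Caps (Setting.labelSucc i) → (thetaIndex X).Fibre (.inr pp)) (m : ℤ),
        haveI : Fact (pp : ℕ).Prime := ⟨pp.2⟩
        (∀ J : DIdx pp.1 ((presAtPr X hlog pp).kk e),
          (pp : ℝ) ^ m * ‖t pp i (e (Fin.last _))‖ ≤
            (pp : ℝ) ^ (-(dSum pp.1 ((presAtPr X hlog pp).kk e) - differentOrd pp.1 (DFac pp.1 ((presAtPr X hlog pp).kk e) J))) *
              ∏ b, ‖cin pp (e b)‖) →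
        (pp : ℝ) ^ m * ‖tq pp (e (Fin.last _))‖ ≤ ∏ b, ‖cout pp (e b)‖ := by
  rw [Cor312.Setting.slotLicence_iff]
  constructor
  · intro h pp i e m hm
    haveI : Fact (pp : ℕ).Prime := ⟨pp.2⟩
    refine (qRegion_subset_thetaSlotHull_settingPrVolSharp_iff_radii X hlog M archPk archSub Ψ act Mmod region n lat sig split qData t tq htq0 htq1
      ht0 cin cout hin0 hin hmax houtΛ hdom (Setting.labelSucc i) pp).mp (h i (.inr pp)) e m fun J => ?_
    rw [PadicPresentation.labelIdele_labelSucc]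
    exact hm J
  · intro h i vQ
    rcases vQ with u | pp
    · exact qRegion_subset_thetaSlotHull_settingPrVolSharp_inl X hlog M archPk archSub Ψ act Mmod region n lat sig split qData t tq htq0 htq1 _ u
    · haveI : Fact (pp : ℕ).Prime := ⟨pp.2⟩
      refine (qRegion_subset_thetaSlotHull_settingPrVolSharp_iff_radii X hlog M archPk archSub Ψ act Mmod region n lat sig split qData t tq htq0
        htq1 ht0 cin cout hin0 hin hmax houtΛ hdom (Setting.labelSucc i) pp).mpr fun e m hm => h pp i e m fun J => ?_
      have := hm J
      rwa [PadicPresentation.labelIdele_labelSucc] at this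

end Radii

end Summit.ABC.IUTFork.Thm311.Real

end
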